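import Literature.Analysis.FluidPDE.NovackScalingLaws
import Literature.Analysis.FluidPDE.DistributionalToWeak
import HarnessLib

/-!
# Novack's local laws for the tree's weak Euler solutions (the time-cutoff bridge)

Topic: Analysis/FluidPDE, proofs companion to `Literature.Analysis.FluidPDE.NovackScalingLaws`.

`NovackScalingLaws` vendors Novack 2024, Thm. 1 (the unconditional local 4/3, 4/5 and 8/15 laws)
keyed on Novack's own weak formulation `Torus.IsWeakEulerSolutionWithPressureOn T f u₀ u p`
(pressure-explicit, with datum and endpoint terms, tested against all smooth fields on
`ℝ × T^d`), and proves the corrected forms of the misstated facts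
`Torus.HasDuchonRobertDefect.hasFourFifthsLaw` / `hasFourThirdsLaw` for such solutions. The
misstated facts themselves are keyed on the tree's pressure-free interior notion
`Torus.IsWeakEulerSolutionOn T u` (De Lellis–Székelyhidi). This file closes the gap:

* `Torus.IsDistributionalNSSolutionOn.isWeakEulerSolutionWithPressureOn` (**proved**, the
  routine time-cutoff argument): an unforced distributional Euler solution `(u, p)` on
  `(0,T) × T^d` (`Torus.IsDistributionalNSSolutionOn T 0 0 u p`, tests compactly supported in
  `(0, T)`) which is continuous in time with values in `L²` on `[0, T]`
  (`Torus.ContinuousInLpOn (Icc 0 T) 2 u`) is a weak solution in Novack's sense on `[0, T]` with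
  datum `u 0`: test the interior identity with `χ_δ(t) φ(t,x)`, `χ_δ = η_δ(t) η_δ(T − t)` a smooth
  plateau (`η_δ` the accepted one-sided cut-off `FluidPDE.exists_smooth_time_cutoff`), so that
  `∂ₜ(χ_δ φ) = (ρ_δ(t) − ρ_δ(T−t)) φ + χ_δ ∂ₜφ`; as `δ → 0` the plateau term tends to the full
  space–time integral (dominated convergence) and the two bump terms to `⟨u(0), φ(0)⟩` and
  `⟨u(T), φ(T)⟩` (`FluidPDE.tendsto_setIntegral_mul_of_ae_tendsto`, the pairing `t ↦ ⟨u(t), φ(t)⟩`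
  being continuous at the endpoints by the `L²` continuity of `u` and the uniform Lipschitz
  continuity in time of `φ`) — Robinson–Rodrigo–Sadowski 2016, §3.1 (derivation of (3.1)) run at
  both ends of `[0, T]`.
* `Torus.HasDuchonRobertDefect.hasFourFifthsLaw_of_isWeakEulerSolutionOn`,
  `hasFourThirdsLaw_of_isWeakEulerSolutionOn`, `tendsto_mixedFlux_of_isWeakEulerSolutionOn`
  (**proved**): the corrected statements with *exactly the hypotheses of the misstated facts*
  (`HasDuchonRobertDefect T u D`, `IsWeakEulerSolutionOn T u`, `u ∈ L³`) **plus** Novack's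
  standing hypothesis `ContinuousInLpOn (Icc 0 T) 2 u`, `2 ≤ card d`, `0 < T`, granted the three
  named facts of the printed chain: the Calderón–Zygmund pressure
  (`Torus.exists_pressure_of_tendsto_L3`; Duchon–Robert 2000, Prop. 1 / Robinson–Rodrigo–Sadowski
  2016, Lemma 5.1 and Prop. 5.3), Duchon–Robert's Prop. 2 (`FluidPDE.duchon_robert_defect_exists`)
  and Novack's Thm. 1 (`Torus.novack2024_fourThirds_fourFifths`, `Torus.novack2024_transverseLaw`).

## References

* M. Novack, *Scaling laws and exact results in turbulence*, Nonlinearity 37 (2024) 095002,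
  arXiv:2310.01375, §1 (weak formulation p. 4, Thm. 1). [Novack2024]
* J. C. Robinson, J. L. Rodrigo, W. Sadowski, *The Three-Dimensional Navier–Stokes Equations*,
  CUP 2016, §3.1 (time integration by parts in the weak formulation), Lemma 5.1, Prop. 5.3.
  [RobinsonRodrigoSadowski2016]
* J. Duchon, R. Robert, Nonlinearity 13 (2000) 249–255, Prop. 1–2. [DuchonRobert2000]
-/

noncomputable section

open MeasureTheory TopologicalSpace Set Function Filter Topology Metric
open scoped InnerProductSpace RealInnerProductSpace ENNReal NNReal

namespace Literature.Analysis.FluidPDE.Torus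

variable {d : Type*} [Fintype d]

/-! ## A two-sided smooth time cut-off -/

/-- **Two-sided smooth plateau.** For `0 < δ` with `6δ ≤ T` there are `χ, ρ : ℝ → ℝ` with `χ`
smooth, `χ = 0` on `(-∞, δ]` and on `[T − δ, ∞)`, `0 ≤ χ ≤ 1`, `χ = 1` on `[3δ, T − 3δ]`, and
`χ' (t) = ρ(t) − ρ(T − t)` where `ρ ≥ 0` is continuous, supported in `(δ, 3δ)`, of unit mass
(`χ(t) = η(t) η(T − t)` with `η` the one-sided cut-off of `FluidPDE.exists_smooth_time_cutoff`). [folklore] -/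
theorem exists_smooth_time_plateau {δ T : ℝ} (hδ : 0 < δ) (hδT : 6 * δ ≤ T) :
    ∃ χ ρ : ℝ → ℝ, ContDiff ℝ (⊤ : ℕ∞) χ ∧ (∀ t, t ≤ δ → χ t = 0) ∧ (∀ t, T - δ ≤ t → χ t = 0) ∧
      (∀ t, χ t ∈ Icc (0 : ℝ) 1) ∧ (∀ t, 3 * δ ≤ t → t ≤ T - 3 * δ → χ t = 1) ∧
      (∀ t, HasDerivAt χ (ρ t - ρ (T - t)) t) ∧ Continuous ρ ∧ (∀ s, 0 ≤ ρ s) ∧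
      (∀ s, s ∉ Ioo δ (3 * δ) → ρ s = 0) ∧ ∫ s, ρ s = 1 := by
  obtain ⟨η, ρ, hηs, hρc, hηρ, hη0, hη1, hη01, hρ0, hρsupp, hρ1⟩ :=
    FluidPDE.exists_smooth_time_cutoff hδ
  refine ⟨fun t => η t * η (T - t), ρ, hηs.mul (hηs.comp (contDiff_const.sub contDiff_id)),
    fun t ht => by simp [hη0 t ht], fun t ht => by simp [hη0 (T - t) (by linarith)],
    fun t => ⟨mul_nonneg (hη01 t).1 (hη01 _).1, mul_le_one₀ (hη01 t).2 (hη01 _).1 (hη01 _).2⟩,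
    fun t h1 h2 => by beta_reduce; rw [hη1 t h1, hη1 (T - t) (by linarith), one_mul],
    fun t => ?_, hρc, hρ0,
    hρsupp, hρ1⟩
  have h := (hηρ t).mul ((hηρ (T - t)).comp t ((hasDerivAt_const t T).sub (hasDerivAt_id' t)))
  have e : ρ t * η (T - t) + η t * (ρ (T - t) * (0 - 1)) = ρ t - ρ (T - t) := by
    by_cases h1 : ρ t = 0
    · by_cases h2 : ρ (T - t) = 0
      · simp [h1, h2]
      · have ht : T - t ∈ Ioo δ (3 * δ) := by
          by_contra hc
          exact h2 (hρsupp _ hc)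
        rw [h1, hη1 t (by linarith [ht.2])]
        ring
    · have ht : t ∈ Ioo δ (3 * δ) := by
        by_contra hc
        exact h1 (hρsupp _ hc)
      have h3 : η (T - t) = 1 := hη1 _ (by linarith [ht.2])
      by_cases h2 : ρ (T - t) = 0
      · rw [h2, h3]; ring
      · have ht' : T - t ∈ Ioo δ (3 * δ) := by
          by_contra hc
          exact h2 (hρsupp _ hc)
        rw [h3, hη1 t (by linarith [ht'.2])]
        ring
  rw [← e]
  exact h

/-! ## Calculus of the cut-off test fields `χ(t) φ(t, x)` -/

section CutoffField

variable [DecidableEq d]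
variable {F : Type*} [NormedAddCommGroup F] [NormedSpace ℝ F]

omit [DecidableEq d] in
/-- `χ(t) φ(t,x)` is a space–time test field supported in `(0, T)` when `χ` is smooth and vanishes
on `(-∞, δ]` and on `[T − δ, ∞)` for some `δ > 0`, and `φ` has smooth space–time lift. [folklore] -/
theorem isSpaceTimeTestIoo_smul_time {T δ : ℝ} (hδ : 0 < δ) {χ : ℝ → ℝ} (hχ : ContDiff ℝ (⊤ : ℕ∞) χ)
    (h0 : ∀ t, t ≤ δ → χ t = 0) (hT : ∀ t, T - δ ≤ t → χ t = 0) {φ : ℝ → UnitAddTorus d → F}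
    (hφ : ContDiff ℝ ((⊤ : ℕ∞) : WithTop ℕ∞) (FunctionSpaces.Torus.stLift φ)) :
    FunctionSpaces.Torus.IsSpaceTimeTestIoo T (fun t x => χ t • φ t x) := by
  refine ⟨⟨?_, T - δ, by linarith, fun t ht => funext fun x => by simp [hT t ht]⟩, δ, hδ,
    fun t ht => funext fun x => by simp [h0 t ht]⟩
  show ContDiff ℝ _ fun q : ℝ × EuclideanSpace ℝ d => χ q.1 • FunctionSpaces.Torus.stLift φ q
  exact (hχ.comp contDiff_fst).smul hφ

omit [DecidableEq d] in
/-- Time slices of a field with smooth space–time lift are differentiable in time with derivative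
`∂ₜφ`. [folklore] -/
theorem hasDerivAt_slice_of_contDiff {φ : ℝ → UnitAddTorus d → F}
    (hφ : ContDiff ℝ ((⊤ : ℕ∞) : WithTop ℕ∞) (FunctionSpaces.Torus.stLift φ)) (t : ℝ) (x : UnitAddTorus d) :
    HasDerivAt (fun τ => φ τ x) (FunctionSpaces.Torus.timeDeriv φ t x) t := by
  obtain ⟨y, rfl⟩ := FunctionSpaces.Torus.proj_surjective x
  have : DifferentiableAt ℝ (fun τ : ℝ => φ τ (FunctionSpaces.Torus.proj y)) t :=
    ((hφ.differentiable (by simp)).comp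
      (differentiable_id.prodMk (differentiable_const y))).differentiableAt
  exact this.hasDerivAt

omit [DecidableEq d] in
/-- Product rule in time: `∂ₜ(χ φ)(t,x) = χ'(t) φ(t,x) + χ(t) ∂ₜφ(t,x)`. [folklore] -/
theorem timeDeriv_smul_time {χ : ℝ → ℝ} {χ' : ℝ} {t : ℝ} (hχ : HasDerivAt χ χ' t)
    {φ : ℝ → UnitAddTorus d → F} (hφ : ContDiff ℝ ((⊤ : ℕ∞) : WithTop ℕ∞) (FunctionSpaces.Torus.stLift φ))
    (x : UnitAddTorus d) :
    FunctionSpaces.Torus.timeDeriv (fun t x => χ t • φ t x) t x =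
      χ' • φ t x + χ t • FunctionSpaces.Torus.timeDeriv φ t x := by
  have h := hχ.smul (hasDerivAt_slice_of_contDiff hφ t x)
  rw [add_comm] at h
  exact h.deriv

omit [DecidableEq d] in
/-- Homogeneity of the convective derivative: `(v·∇)(c φ) = c (v·∇)φ` for `C¹` slices. [folklore] -/
theorem convect_smul_const (v : UnitAddTorus d → EuclideanSpace ℝ d) {g : UnitAddTorus d → F}
    (hg : FunctionSpaces.Torus.IsContDiff 1 g) (c : ℝ) (x : UnitAddTorus d) :
    FunctionSpaces.Torus.convect v (fun y => c • g y) x = c • FunctionSpaces.Torus.convect v g x := by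
  simp only [FunctionSpaces.Torus.convect]
  rw [show (fun y => c • g y) = c • g from rfl, FunctionSpaces.Torus.fderiv_const_smul hg c x]
  rfl

/-- Homogeneity of the divergence: `div (c φ) = c div φ` for `C¹` slices. [folklore] -/
theorem divergence_smul_const {g : UnitAddTorus d → EuclideanSpace ℝ d}
    (hg : FunctionSpaces.Torus.IsContDiff 1 g) (c : ℝ) (x : UnitAddTorus d) :
    FunctionSpaces.Torus.divergence (fun y => c • g y) x = c * FunctionSpaces.Torus.divergence g x := by
  simp only [FunctionSpaces.Torus.divergence, Finset.mul_sum]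
  refine Finset.sum_congr rfl fun i _ => ?_
  have hgi : FunctionSpaces.Torus.IsContDiff 1 (fun y => g y i) :=
    (EuclideanSpace.proj i : EuclideanSpace ℝ d →L[ℝ] ℝ).contDiff.comp hg
  have h : (fun y => (c • g y) i) = c • fun y => g y i := by
    funext y; simp [PiLp.smul_apply]
  rw [h, FunctionSpaces.Torus.partialDeriv_const_smul hgi c i, Pi.smul_apply, smul_eq_mul]

end CutoffField

/-! ## Continuity of the pairing `t ↦ ⟨u(t), φ(t)⟩` at the endpoints -/

section Pairing

variable [DecidableEq d]
variable {T : ℝ} {u : ℝ → UnitAddTorus d → EuclideanSpace ℝ d}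

omit [DecidableEq d] in
/-- Uniform Lipschitz continuity in time of a field with smooth space–time lift on `[0, T] × T^d`:
`‖φ(t,x) − φ(t₀,x)‖ ≤ C |t − t₀|` with `C` a bound of `∂ₜφ` on `[0, T]` (mean value inequality). [folklore] -/
theorem norm_slice_sub_le_of_contDiff {φ : ℝ → UnitAddTorus d → EuclideanSpace ℝ d}
    (hφ : ContDiff ℝ ((⊤ : ℕ∞) : WithTop ℕ∞) (FunctionSpaces.Torus.stLift φ)) {C : ℝ}
    (hC : ∀ t ∈ Icc 0 T, ∀ x, ‖FunctionSpaces.Torus.timeDeriv φ t x‖ ≤ C)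
    {t t₀ : ℝ} (ht : t ∈ Icc 0 T) (ht₀ : t₀ ∈ Icc 0 T) (x : UnitAddTorus d) :
    ‖φ t x - φ t₀ x‖ ≤ C * |t - t₀| := by
  have h := (convex_Icc 0 T).norm_image_sub_le_of_norm_hasDerivWithin_le
    (f := fun τ => φ τ x) (f' := fun τ => FunctionSpaces.Torus.timeDeriv φ τ x)
    (fun τ _ => (hasDerivAt_slice_of_contDiff hφ τ x).hasDerivWithinAt) (fun τ hτ => hC τ hτ x)
    ht₀ ht
  simpa [Real.norm_eq_abs] using h

omit [DecidableEq d] in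
/-- **Continuity of the pairing at a time of `[0, T]`.** If `u ∈ C⁰([0,T]; L²(T^d))` and `φ` has
smooth space–time lift, then `t ↦ ∫ ⟪u(t), φ(t)⟫` is continuous on `[0, T]`, quantitatively:
for every `ε > 0` there is `γ > 0` with `|∫ ⟪u t, φ t⟫ − ∫ ⟪u t₀, φ t₀⟫| ≤ ε` for `t ∈ [0,T]`,
`|t − t₀| < γ` (Cauchy–Schwarz on the probability space `T^d` and the uniform Lipschitz bound
`norm_slice_sub_le_of_contDiff`). [folklore] -/
theorem ContinuousInLpOn.abs_pairing_sub_le (hC : ContinuousInLpOn (Icc 0 T) 2 u)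
    {φ : ℝ → UnitAddTorus d → EuclideanSpace ℝ d}
    (hφ : ContDiff ℝ ((⊤ : ℕ∞) : WithTop ℕ∞) (FunctionSpaces.Torus.stLift φ)) {t₀ : ℝ} (ht₀ : t₀ ∈ Icc 0 T)
    {ε : ℝ} (hε : 0 < ε) :
    ∃ γ > 0, ∀ t ∈ Icc 0 T, |t - t₀| < γ →
      |(∫ x, ⟪u t x, φ t x⟫) - ∫ x, ⟪u t₀ x, φ t₀ x⟫| ≤ ε := by
  -- bounds on `φ` and `∂ₜφ` on `[0, T]`
  have hsm : FunctionSpaces.Torus.IsSmoothSpaceTimeOn univ φ := FunctionSpaces.Torus.isSmoothSpaceTimeOn_of_contDiff hφ univ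
  have hdt : FunctionSpaces.Torus.IsSmoothSpaceTimeOn univ (FunctionSpaces.Torus.timeDeriv φ) := by
    have h := hsm.timeDerivWithin uniqueDiffOn_univ
    have e : FunctionSpaces.Torus.timeDerivWithin univ φ = FunctionSpaces.Torus.timeDeriv φ := by
      funext t x
      exact FunctionSpaces.Torus.timeDerivWithin_eq_timeDeriv_of_contDiff hφ uniqueDiffOn_univ (mem_univ t) x
    rwa [e] at h
  obtain ⟨⟨Cφ, hCφ0, hCφ⟩, -⟩ := hsm.bound_and_measurable T
  obtain ⟨⟨Cdt, hCdt0, hCdt⟩, -⟩ := hdt.bound_and_measurable T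
  -- the `L²` data
  have hmem : ∀ t ∈ Icc 0 T, MemLp (u t) 2 volume := hC.1
  have hI : ∀ t ∈ Icc 0 T, Integrable (u t) volume := fun t ht => (hmem t ht).integrable one_le_two
  set M := ∫ x, ‖u t₀ x‖ with hM
  have hM0 : 0 ≤ M := integral_nonneg fun x => norm_nonneg _
  -- `L²`-continuity at `t₀`, quantitatively
  have hε' : 0 < ε / (2 * (Cφ + 1)) := by positivity
  have hev : ∀ᶠ t in 𝓝[Icc 0 T] t₀, eLpNorm (u t - u t₀) 2 volume ≤ ENNReal.ofReal (ε / (2 * (Cφ + 1))) :=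
    (ENNReal.tendsto_nhds_zero.1 (hC.2 t₀ ht₀)) _ (by simpa using hε')
  rw [eventually_nhdsWithin_iff, Metric.eventually_nhds_iff] at hev
  obtain ⟨γ₁, hγ₁, hγ₁'⟩ := hev
  -- choose `γ`
  have hε'' : 0 < ε / (2 * (Cdt * M + 1)) := by positivity
  refine ⟨min γ₁ (ε / (2 * (Cdt * M + 1))), lt_min hγ₁ hε'', fun t ht htγ => ?_⟩
  have htγ₁ : |t - t₀| < γ₁ := htγ.trans_le (min_le_left _ _)
  have htγ₂ : |t - t₀| < ε / (2 * (Cdt * M + 1)) := htγ.trans_le (min_le_right _ _)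
  have hL2 : eLpNorm (u t - u t₀) 2 volume ≤ ENNReal.ofReal (ε / (2 * (Cφ + 1))) :=
    hγ₁' (by rwa [Real.dist_eq]) ht
  -- integrability of the pairings
  have hpair : ∀ s ∈ Icc 0 T, ∀ r ∈ Icc 0 T, Integrable (fun x => ⟪u s x, φ r x⟫) volume := by
    intro s hs r hr
    refine ((hI s hs).norm.mul_const Cφ).mono' ((hI s hs).1.inner
      ((hsm.isSmooth_slice (mem_univ r)).continuous.aestronglyMeasurable)) (ae_of_all _ fun x => ?_)
    rw [Real.norm_eq_abs]
    exact (abs_real_inner_le_norm _ _).trans (mul_le_mul_of_nonneg_left (hCφ r hr x) (norm_nonneg _))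
  -- split the difference
  have hf : Integrable (fun x => ⟪u t x - u t₀ x, φ t x⟫) volume :=
    ((hpair t ht t ht).sub (hpair t₀ ht₀ t ht)).congr
      (ae_of_all _ fun x => by simp only [Pi.sub_apply, inner_sub_left])
  have hg : Integrable (fun x => ⟪u t₀ x, φ t x - φ t₀ x⟫) volume :=
    ((hpair t₀ ht₀ t ht).sub (hpair t₀ ht₀ t₀ ht₀)).congr
      (ae_of_all _ fun x => by simp only [Pi.sub_apply, inner_sub_right])
  have hsplit : (∫ x, ⟪u t x, φ t x⟫) - ∫ x, ⟪u t₀ x, φ t₀ x⟫ =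
      (∫ x, ⟪u t x - u t₀ x, φ t x⟫) + ∫ x, ⟪u t₀ x, φ t x - φ t₀ x⟫ := by
    rw [← integral_add hf hg, ← integral_sub (hpair t ht t ht) (hpair t₀ ht₀ t₀ ht₀)]
    refine integral_congr_ae (ae_of_all _ fun x => ?_)
    simp only [inner_sub_left, inner_sub_right]
    ring
  rw [hsplit]
  -- first term: Cauchy–Schwarz on the probability space
  have h1 : |∫ x, ⟪u t x - u t₀ x, φ t x⟫| ≤ Cφ * (ε / (2 * (Cφ + 1))) := by
    have hmeas : AEStronglyMeasurable (u t - u t₀) volume := (hI t ht).1.sub (hI t₀ ht₀).1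
    have hfin : eLpNorm (u t - u t₀) 2 volume < ∞ := ((hmem t ht).sub (hmem t₀ ht₀)).eLpNorm_lt_top
    have hint : Integrable (u t - u t₀) volume := (hI t ht).sub (hI t₀ ht₀)
    calc |∫ x, ⟪u t x - u t₀ x, φ t x⟫| ≤ ∫ x, |⟪u t x - u t₀ x, φ t x⟫| := abs_integral_le_integral_abs
      _ ≤ ∫ x, Cφ * ‖(u t - u t₀) x‖ := by
          refine integral_mono_of_nonneg (ae_of_all _ fun x => abs_nonneg _)
            (hint.norm.const_mul Cφ) (ae_of_all _ fun x => ?_)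
          beta_reduce
          rw [Pi.sub_apply, mul_comm]
          exact (abs_real_inner_le_norm _ _).trans
            (mul_le_mul_of_nonneg_left (hCφ t ht x) (norm_nonneg _))
      _ = Cφ * (eLpNorm (u t - u t₀) 1 volume).toReal := by
          rw [integral_const_mul, integral_norm_eq_lintegral_enorm hmeas, eLpNorm_one_eq_lintegral_enorm]
      _ ≤ Cφ * (eLpNorm (u t - u t₀) 2 volume).toReal :=
          mul_le_mul_of_nonneg_left (ENNReal.toReal_mono hfin.ne
            (eLpNorm_le_eLpNorm_of_exponent_le one_le_two hmeas)) hCφ0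
      _ ≤ Cφ * (ε / (2 * (Cφ + 1))) :=
          mul_le_mul_of_nonneg_left (ENNReal.toReal_le_of_le_ofReal hε'.le hL2) hCφ0
  -- second term: uniform Lipschitz bound in time
  have h2 : |∫ x, ⟪u t₀ x, φ t x - φ t₀ x⟫| ≤ Cdt * |t - t₀| * M := by
    calc |∫ x, ⟪u t₀ x, φ t x - φ t₀ x⟫| ≤ ∫ x, |⟪u t₀ x, φ t x - φ t₀ x⟫| := abs_integral_le_integral_abs
      _ ≤ ∫ x, Cdt * |t - t₀| * ‖u t₀ x‖ := by
          refine integral_mono_of_nonneg (ae_of_all _ fun x => abs_nonneg _)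
            ((hI t₀ ht₀).norm.const_mul _) (ae_of_all _ fun x => ?_)
          beta_reduce
          calc |⟪u t₀ x, φ t x - φ t₀ x⟫| ≤ ‖u t₀ x‖ * ‖φ t x - φ t₀ x‖ := abs_real_inner_le_norm _ _
            _ ≤ ‖u t₀ x‖ * (Cdt * |t - t₀|) :=
                mul_le_mul_of_nonneg_left (norm_slice_sub_le_of_contDiff hφ hCdt ht ht₀ x) (norm_nonneg _)
            _ = Cdt * |t - t₀| * ‖u t₀ x‖ := by ring
      _ = Cdt * |t - t₀| * M := by rw [integral_const_mul]
  -- conclusion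
  have k1 : Cφ * (ε / (2 * (Cφ + 1))) ≤ ε / 2 := by
    rw [mul_div_assoc']
    rw [div_le_div_iff₀ (by positivity) (by positivity)]
    nlinarith
  have k2 : Cdt * |t - t₀| * M ≤ ε / 2 := by
    have h3 : Cdt * |t - t₀| * M = (Cdt * M) * |t - t₀| := by ring
    rw [h3]
    calc Cdt * M * |t - t₀| ≤ (Cdt * M) * (ε / (2 * (Cdt * M + 1))) :=
          mul_le_mul_of_nonneg_left htγ₂.le (by positivity)
      _ ≤ ε / 2 := by
          rw [mul_div_assoc', div_le_div_iff₀ (by positivity) (by positivity)]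
          nlinarith
  calc |(∫ x, ⟪u t x - u t₀ x, φ t x⟫) + ∫ x, ⟪u t₀ x, φ t x - φ t₀ x⟫|
      ≤ |∫ x, ⟪u t x - u t₀ x, φ t x⟫| + |∫ x, ⟪u t₀ x, φ t x - φ t₀ x⟫| := abs_add_le _ _
    _ ≤ ε / 2 + ε / 2 := add_le_add (h1.trans k1) (h2.trans k2)
    _ = ε := by ring

end Pairing

/-! ## From the interior distributional formulation to Novack's weak formulation -/

section Bridge

variable [DecidableEq d]
variable {T : ℝ} {u : ℝ → UnitAddTorus d → EuclideanSpace ℝ d} {p : ℝ → UnitAddTorus d → ℝ}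

/-- Reflection `t ↦ T − t` of the time variable: set integrals over `(0, T)`. [folklore] -/
theorem setIntegral_Ioo_comp_const_sub (g : ℝ → ℝ) (T : ℝ) :
    ∫ t in Ioo 0 T, g (T - t) = ∫ t in Ioo 0 T, g t := by
  have hmp : MeasurePreserving (fun t : ℝ => T - t) volume volume :=
    Measure.measurePreserving_sub_left volume T
  have h := hmp.setIntegral_preimage_emb (measurableEmbedding_subLeft T) g (Ioo 0 T)
  have hpre : (fun t : ℝ => T - t) ⁻¹' Ioo 0 T = Ioo 0 T := by
    ext t
    simp only [mem_preimage, mem_Ioo]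
    constructor <;> rintro ⟨h1, h2⟩ <;> constructor <;> linarith
  rwa [hpre] at h

/-- Reflection `t ↦ T − t` of the time variable: integrability over `(0, T)`. [folklore] -/
theorem integrableOn_Ioo_comp_const_sub {g : ℝ → ℝ} {T : ℝ} (hg : IntegrableOn g (Ioo 0 T)) :
    IntegrableOn (fun t => g (T - t)) (Ioo 0 T) := by
  have hmp : MeasurePreserving (fun t : ℝ => T - t) volume volume :=
    Measure.measurePreserving_sub_left volume T
  have hpre : (fun t : ℝ => T - t) ⁻¹' Ioo 0 T = Ioo 0 T := by
    ext t
    simp only [mem_preimage, mem_Ioo]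
    constructor <;> rintro ⟨h1, h2⟩ <;> constructor <;> linarith
  have h := (hmp.integrableOn_comp_preimage (measurableEmbedding_subLeft T) (f := g) (s := Ioo 0 T)).2 hg
  rwa [hpre] at h

/-- **The time-cutoff bridge.** An unforced distributional Euler solution `(u, p)` on
`(0,T) × T^d` (pressure-explicit, tests compactly supported in `(0, T)`; `u ∈ L²_{t,x}`,
`p ∈ L¹_{t,x}`) which is continuous on `[0, T]` with values in `L²(T^d)` is a weak solution in
Novack's sense on `[0, T]` with datum `u 0` (Novack 2024, §1, weak formulation p. 4):
for every smooth `φ` on `ℝ × T^d`,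
`∫₀ᵀ∫ (⟪u, ∂ₜφ⟫ + ⟪u, (u·∇)φ⟫ + p div φ) + ∫ ⟪u(0), φ(0)⟫ − ∫ ⟪u(T), φ(T)⟫ = 0`.
Proof: test the interior identity with the plateau cut-offs `χ_δ(t) φ(t,x)`
(`exists_smooth_time_plateau`), `∂ₜ(χ_δφ) = (ρ_δ(t) − ρ_δ(T−t))φ + χ_δ∂ₜφ`; as `δ → 0⁺` the plateau
term tends to the full integral by dominated convergence and the two bump terms to the endpoint
pairings (`FluidPDE.tendsto_setIntegral_mul_of_ae_tendsto` at `t = 0⁺` and, after the reflection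
`t ↦ T − t`, at `t = T⁻`; continuity of the pairing from `ContinuousInLpOn.abs_pairing_sub_le`)
— the time integration by parts of Robinson–Rodrigo–Sadowski 2016, §3.1 at both ends. [cite: Novack2024, Sect. 1 p. 4 weak formulation preceding Thm. 1] -/
theorem IsDistributionalNSSolutionOn.isWeakEulerSolutionWithPressureOn
    (hsol : IsDistributionalNSSolutionOn T 0 0 u p) (hC : ContinuousInLpOn (Icc 0 T) 2 u)
    (hT : 0 < T) : IsWeakEulerSolutionWithPressureOn T 0 (u 0) u p := by
  refine ⟨hsol.1, hsol.2.1, hsol.2.2.1, hsol.2.2.2.1, hsol.2.2.2.2.1, fun φ hφ => ?_⟩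
  set μT := (volume.restrict (Ioo 0 T)).prod (volume : Measure (UnitAddTorus d)) with hμT
  -- smoothness, bounds and measurability of the derived fields of `φ`
  have hsm : FunctionSpaces.Torus.IsSmoothSpaceTimeOn univ φ := FunctionSpaces.Torus.isSmoothSpaceTimeOn_of_contDiff hφ univ
  have hdt : FunctionSpaces.Torus.IsSmoothSpaceTimeOn univ (FunctionSpaces.Torus.timeDeriv φ) := by
    have h := hsm.timeDerivWithin uniqueDiffOn_univ
    have e : FunctionSpaces.Torus.timeDerivWithin univ φ = FunctionSpaces.Torus.timeDeriv φ := by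
      funext t x
      exact FunctionSpaces.Torus.timeDerivWithin_eq_timeDeriv_of_contDiff hφ uniqueDiffOn_univ (mem_univ t) x
    rwa [e] at h
  have hB : FunctionSpaces.Torus.IsSmoothSpaceTimeOn univ (fun t x => FunctionSpaces.Torus.fderiv (φ t) x) :=
    hsm.torusFderiv uniqueDiffOn_univ
  have hdv : FunctionSpaces.Torus.IsSmoothSpaceTimeOn univ (fun t => FunctionSpaces.Torus.divergence (φ t)) :=
    hsm.divergence uniqueDiffOn_univ
  obtain ⟨⟨Cφ, hCφ0, hCφ⟩, hφm⟩ := hsm.bound_and_measurable T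
  obtain ⟨⟨Cdt, hCdt0, hCdt⟩, hdtm⟩ := hdt.bound_and_measurable T
  obtain ⟨⟨CB, hCB0, hCB⟩, hBm⟩ := hB.bound_and_measurable T
  obtain ⟨⟨Cdv, hCdv0, hCdv⟩, hdvm⟩ := hdv.bound_and_measurable T
  have hφ1 : ∀ t, FunctionSpaces.Torus.IsContDiff 1 (φ t) := fun t =>
    (hsm.isSmooth_slice (mem_univ t)).isContDiff (by simp)
  have hum : AEStronglyMeasurable (uncurry u) μT := aestronglyMeasurable_uncurry_prod hsol.1
  have hpm : AEStronglyMeasurable (uncurry p) μT := aestronglyMeasurable_uncurry_prod hsol.2.2.1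
  have hIoo : ∀ᵐ z ∂μT, z.1 ∈ Ioo 0 T := by
    rw [hμT, ← volume_restrict_Ioo_prod_univ]
    filter_upwards [ae_restrict_mem (measurableSet_Ioo.prod MeasurableSet.univ)] with z hz
    exact hz.1
  -- `u ∈ L²`, `p ∈ L¹` on the slab
  have hu2 : ∫⁻ z, ‖u z.1 z.2‖ₑ ^ 2 ∂μT < ∞ := by
    have e2 : ∫⁻ t in Ioo 0 T, ∫⁻ x, ‖u t x‖ₑ ^ 2 = ∫⁻ z, ‖u z.1 z.2‖ₑ ^ 2 ∂μT :=
      lintegral_Ioo_lintegral_eq_lintegral_prod (hum.enorm.pow_const _)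
    rw [← e2]
    exact hsol.2.1
  have hM2 : MemLp (uncurry u) 2 μT :=
    ⟨hum, (eLpNorm_lt_top_iff_lintegral_rpow_enorm_lt_top two_ne_zero ENNReal.ofNat_ne_top).2
      (by simpa [uncurry] using hu2)⟩
  have I1 : Integrable (fun z : ℝ × UnitAddTorus d => ‖u z.1 z.2‖) μT := (hM2.integrable one_le_two).norm
  have I2 : Integrable (fun z : ℝ × UnitAddTorus d => ‖u z.1 z.2‖ ^ 2) μT :=
    (memLp_two_iff_integrable_sq_norm hum).1 hM2
  have Ip : Integrable (fun z : ℝ × UnitAddTorus d => p z.1 z.2) μT := by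
    refine ⟨hpm, ?_⟩
    have e1 : ∫⁻ t in Ioo 0 T, ∫⁻ x, ‖p t x‖ₑ = ∫⁻ z, ‖p z.1 z.2‖ₑ ∂μT :=
      lintegral_Ioo_lintegral_eq_lintegral_prod hpm.enorm
    have h := hsol.2.2.2.1
    rw [e1] at h
    exact h
  -- the interior integrand `F` and the pairing integrand `P`
  set F : ℝ × UnitAddTorus d → ℝ := fun z => ⟪u z.1 z.2, FunctionSpaces.Torus.timeDeriv φ z.1 z.2⟫ +
    ⟪u z.1 z.2, FunctionSpaces.Torus.fderiv (φ z.1) z.2 (u z.1 z.2)⟫ +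
    p z.1 z.2 * FunctionSpaces.Torus.divergence (φ z.1) z.2 with hF
  set P : ℝ × UnitAddTorus d → ℝ := fun z => ⟪u z.1 z.2, φ z.1 z.2⟫ with hP
  have hBv : AEStronglyMeasurable (fun z : ℝ × UnitAddTorus d =>
      FunctionSpaces.Torus.fderiv (φ z.1) z.2 (u z.1 z.2)) μT :=
    (show Continuous (fun q : (EuclideanSpace ℝ d →L[ℝ] EuclideanSpace ℝ d) × EuclideanSpace ℝ d =>
      q.1 q.2) from isBoundedBilinearMap_apply.continuous).comp_aestronglyMeasurable₂ hBm hum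
  have hFm : AEStronglyMeasurable F μT :=
    ((hum.inner hdtm).add (hum.inner hBv)).add (hpm.mul hdvm)
  have IF : Integrable F μT := by
    refine Integrable.mono' (((I1.const_mul Cdt).add (I2.const_mul CB)).add (Ip.norm.const_mul Cdv)) hFm ?_
    filter_upwards [hIoo] with z hz
    have hz' : z.1 ∈ Icc 0 T := Ioo_subset_Icc_self hz
    have ha0 : 0 ≤ ‖u z.1 z.2‖ := norm_nonneg _
    have k1 : |⟪u z.1 z.2, FunctionSpaces.Torus.timeDeriv φ z.1 z.2⟫| ≤ Cdt * ‖u z.1 z.2‖ := by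
      rw [mul_comm]
      exact (abs_real_inner_le_norm _ _).trans (mul_le_mul_of_nonneg_left (hCdt z.1 hz' z.2) ha0)
    have k2 : |⟪u z.1 z.2, FunctionSpaces.Torus.fderiv (φ z.1) z.2 (u z.1 z.2)⟫| ≤ CB * ‖u z.1 z.2‖ ^ 2 := by
      refine (abs_real_inner_le_norm _ _).trans ?_
      have := ((FunctionSpaces.Torus.fderiv (φ z.1) z.2).le_opNorm (u z.1 z.2)).trans
        (mul_le_mul_of_nonneg_right (hCB z.1 hz' z.2) ha0)
      nlinarith
    have k3 : |p z.1 z.2 * FunctionSpaces.Torus.divergence (φ z.1) z.2| ≤ Cdv * ‖p z.1 z.2‖ := by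
      rw [abs_mul, mul_comm, Real.norm_eq_abs]
      exact mul_le_mul_of_nonneg_right (by simpa [Real.norm_eq_abs] using hCdv z.1 hz' z.2) (abs_nonneg _)
    rw [Real.norm_eq_abs]
    refine (abs_add_le _ _).trans ((add_le_add ((abs_add_le _ _).trans (add_le_add k1 k2)) k3).trans ?_)
    exact le_of_eq rfl
  have IP : Integrable P μT := by
    refine Integrable.mono' (I1.mul_const Cφ) (hum.inner hφm) ?_
    filter_upwards [hIoo] with z hz
    rw [Real.norm_eq_abs]
    exact (abs_real_inner_le_norm _ _).trans
      (mul_le_mul_of_nonneg_left (hCφ z.1 (Ioo_subset_Icc_self hz) z.2) (norm_nonneg _))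
  -- the pairing `U(t) = ∫ ⟪u t, φ t⟫` and its endpoint values
  set U : ℝ → ℝ := fun t => ∫ x, ⟪u t x, φ t x⟫ with hU
  have hUint : IntegrableOn U (Ioo 0 T) := IP.integral_prod_left
  -- rewrite the goal in product form
  simp only [Pi.zero_apply, inner_zero_left, add_zero]
  rw [show (∫ t in Ioo 0 T, ∫ x, (⟪u t x, FunctionSpaces.Torus.timeDeriv φ t x⟫ +
      ⟪u t x, FunctionSpaces.Torus.convect (u t) (φ t) x⟫ +
      p t x * FunctionSpaces.Torus.divergence (φ t) x)) = ∫ z, F z ∂μT from (integral_prod _ IF).symm]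
  -- the plateau cut-offs along `δ_k = T / (6 (k + 2))`
  set δ : ℕ → ℝ := fun k => T / (6 * ((k : ℝ) + 2)) with hδ
  have hδpos : ∀ k, 0 < δ k := fun k => by positivity
  have hδ6 : ∀ k, 6 * δ k ≤ T := fun k => by
    rw [hδ]
    rw [show 6 * (T / (6 * ((k : ℝ) + 2))) = T / ((k : ℝ) + 2) by field_simp]
    exact div_le_self hT.le (by linarith [(k.cast_nonneg : (0 : ℝ) ≤ k)])
  have hδ3 : ∀ k, 3 * δ k ≤ T := fun k => by linarith [hδ6 k, hδpos k]
  have hδ0 : Tendsto δ atTop (𝓝 0) := by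
    have h1 : Tendsto (fun k : ℕ => 6 * ((k : ℝ) + 2)) atTop atTop :=
      (tendsto_natCast_atTop_atTop.atTop_add tendsto_const_nhds).const_mul_atTop (by norm_num)
    exact tendsto_const_nhds.div_atTop h1
  choose χ ρ hχs hχ0 hχT hχ01 hχ1 hχ' hρc hρ0 hρsupp hρ1 using
    fun k => exists_smooth_time_plateau (hδpos k) (hδ6 k)
  -- Step 1: the tested identity for each `k`
  have hid : ∀ k, (∫ t in Ioo 0 T, ρ k t * U t) - (∫ t in Ioo 0 T, ρ k (T - t) * U t) +
      ∫ z, F z * χ k z.1 ∂μT = 0 := by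
    intro k
    have hψ : FunctionSpaces.Torus.IsSpaceTimeTestIoo T (fun t x => χ k t • φ t x) :=
      isSpaceTimeTestIoo_smul_time (hδpos k) (hχs k) (hχ0 k) (hχT k) hφ
    have h0 := hsol.2.2.2.2.2 _ hψ
    -- pointwise form of the tested integrand
    have hpt : ∀ t x, ⟪u t x, FunctionSpaces.Torus.timeDeriv (fun t x => χ k t • φ t x) t x⟫ +
        ⟪u t x, FunctionSpaces.Torus.convect (u t) (fun x => χ k t • φ t x) x⟫ +
        0 * ⟪u t x, FunctionSpaces.Torus.laplacian (fun x => χ k t • φ t x) x⟫ +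
        p t x * FunctionSpaces.Torus.divergence (fun x => χ k t • φ t x) x +
        ⟪(0 : ℝ → UnitAddTorus d → EuclideanSpace ℝ d) t x, χ k t • φ t x⟫ =
        P (t, x) * (ρ k t - ρ k (T - t)) + F (t, x) * χ k t := by
      intro t x
      rw [timeDeriv_smul_time (hχ' k t) hφ x, convect_smul_const (u t) (hφ1 t) (χ k t) x,
        divergence_smul_const (hφ1 t) (χ k t) x]
      simp only [hP, hF, inner_add_right, real_inner_smul_right, Pi.zero_apply, inner_zero_left,
        add_zero, zero_mul]
      simp only [FunctionSpaces.Torus.convect]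
      ring
    -- bounded measurable weights
    obtain ⟨Cρ, hCρ0, hCρ⟩ := FluidPDE.exists_abs_le_of_eq_zero_off_Ioo (hρc k) (hρsupp k)
    have hwm : AEStronglyMeasurable (fun z : ℝ × UnitAddTorus d => ρ k z.1 - ρ k (T - z.1)) μT :=
      (((hρc k).sub ((hρc k).comp (continuous_const.sub continuous_id))).comp
        continuous_fst).aestronglyMeasurable
    have hwb : ∀ᵐ z ∂μT, ‖ρ k z.1 - ρ k (T - z.1)‖ ≤ Cρ + Cρ := ae_of_all _ fun z => by
      rw [Real.norm_eq_abs]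
      exact (abs_sub _ _).trans (add_le_add (hCρ _) (hCρ _))
    have hcm : AEStronglyMeasurable (fun z : ℝ × UnitAddTorus d => χ k z.1) μT :=
      ((hχs k).continuous.comp continuous_fst).aestronglyMeasurable
    have hcb : ∀ᵐ z ∂μT, ‖χ k z.1‖ ≤ 1 := ae_of_all _ fun z => by
      rw [Real.norm_eq_abs, abs_of_nonneg (hχ01 k z.1).1]
      exact (hχ01 k z.1).2
    have IPw : Integrable (fun z => P z * (ρ k z.1 - ρ k (T - z.1))) μT := IP.mul_bdd hwm hwb
    have IFc : Integrable (fun z => F z * χ k z.1) μT := IF.mul_bdd hcm hcb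
    -- the identity in product form
    have h1 : ∫ z, (P z * (ρ k z.1 - ρ k (T - z.1)) + F z * χ k z.1) ∂μT = 0 := by
      rw [integral_prod (fun z => P z * (ρ k z.1 - ρ k (T - z.1)) + F z * χ k z.1) (IPw.add IFc)]
      refine Eq.trans ?_ h0
      refine integral_congr_ae (ae_of_all _ fun t => integral_congr_ae (ae_of_all _ fun x => ?_))
      exact (hpt t x).symm
    rw [integral_add IPw IFc] at h1
    -- the weight term is a time integral of `U`
    have h2 : ∫ z, P z * (ρ k z.1 - ρ k (T - z.1)) ∂μT =
        (∫ t in Ioo 0 T, ρ k t * U t) - ∫ t in Ioo 0 T, ρ k (T - t) * U t := by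
      rw [integral_prod _ IPw]
      dsimp only
      have e : ∀ t, ∫ x, P (t, x) * (ρ k t - ρ k (T - t)) = (ρ k t - ρ k (T - t)) * U t := by
        intro t
        show (∫ x, ⟪u t x, φ t x⟫ * (ρ k t - ρ k (T - t))) = (ρ k t - ρ k (T - t)) * ∫ x, ⟪u t x, φ t x⟫
        rw [integral_mul_const, mul_comm]
      simp_rw [e]
      have IU1 : IntegrableOn (fun t => ρ k t * U t) (Ioo 0 T) :=
        hUint.bdd_mul (hρc k).aestronglyMeasurable.restrict
          (ae_of_all _ fun t => by simpa [Real.norm_eq_abs] using hCρ t)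
      have IU2 : IntegrableOn (fun t => ρ k (T - t) * U t) (Ioo 0 T) :=
        hUint.bdd_mul ((hρc k).comp (continuous_const.sub continuous_id)).aestronglyMeasurable.restrict
          (ae_of_all _ fun t => by simpa [Real.norm_eq_abs] using hCρ (T - t))
      rw [← integral_sub IU1 IU2]
      refine integral_congr_ae (ae_of_all _ fun t => ?_)
      ring
    rw [h2] at h1
    exact h1
  -- Step 2: the three limits
  have hlimF : Tendsto (fun k => ∫ z, F z * χ k z.1 ∂μT) atTop (𝓝 (∫ z, F z ∂μT)) := by
    refine tendsto_integral_of_dominated_convergence (fun z => ‖F z‖)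
      (fun k => hFm.mul (show Continuous (fun z : ℝ × UnitAddTorus d => χ k z.1) from
        (hχs k).continuous.comp continuous_fst).aestronglyMeasurable)
      IF.norm (fun k => ae_of_all _ fun z => ?_) ?_
    · rw [norm_mul]
      refine mul_le_of_le_one_right (norm_nonneg _) ?_
      rw [Real.norm_eq_abs, abs_of_nonneg (hχ01 k z.1).1]
      exact (hχ01 k z.1).2
    · filter_upwards [hIoo] with z hz
      have hev : ∀ᶠ k in atTop, F z * χ k z.1 = F z := by
        have h3 : Tendsto (fun k => 3 * δ k) atTop (𝓝 (3 * 0)) := hδ0.const_mul 3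
        rw [mul_zero] at h3
        have hmin : 0 < min z.1 (T - z.1) := lt_min hz.1 (by linarith [hz.2])
        filter_upwards [(tendsto_order.1 h3).2 _ hmin] with k hk
        rw [hχ1 k z.1 (by linarith [hk.trans_le (min_le_left _ _)])
          (by linarith [hk.trans_le (min_le_right _ _)]), mul_one]
      exact tendsto_const_nhds.congr' (hev.mono fun k hk => hk.symm)
  have hlim0 : Tendsto (fun k => ∫ t in Ioo 0 T, ρ k t * U t) atTop (𝓝 (∫ x, ⟪u 0 x, φ 0 x⟫)) := by
    refine FluidPDE.tendsto_setIntegral_mul_of_ae_tendsto hUint (fun ε hε => ?_) hδ0 hδpos hδ3 hρc hρ0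
      hρsupp hρ1
    obtain ⟨γ, hγ, hγ'⟩ := hC.abs_pairing_sub_le hφ ⟨le_rfl, hT.le⟩ hε
    refine ⟨min γ T, lt_min hγ hT, ?_⟩
    filter_upwards [ae_restrict_mem measurableSet_Ioo] with t ht
    have htT : t ∈ Icc 0 T := ⟨ht.1.le, (ht.2.trans_le (min_le_right _ _)).le⟩
    exact hγ' t htT (by rw [sub_zero, abs_of_pos ht.1]; exact ht.2.trans_le (min_le_left _ _))
  have hlimT : Tendsto (fun k => ∫ t in Ioo 0 T, ρ k (T - t) * U t) atTop (𝓝 (∫ x, ⟪u T x, φ T x⟫)) := by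
    have e : ∀ k, ∫ t in Ioo 0 T, ρ k (T - t) * U t = ∫ t in Ioo 0 T, ρ k t * U (T - t) := by
      intro k
      rw [← setIntegral_Ioo_comp_const_sub (fun t => ρ k t * U (T - t)) T]
      refine integral_congr_ae (ae_of_all _ fun t => ?_)
      simp only [sub_sub_cancel]
    simp_rw [e]
    refine FluidPDE.tendsto_setIntegral_mul_of_ae_tendsto (integrableOn_Ioo_comp_const_sub hUint)
      (fun ε hε => ?_) hδ0 hδpos hδ3 hρc hρ0 hρsupp hρ1
    obtain ⟨γ, hγ, hγ'⟩ := hC.abs_pairing_sub_le hφ ⟨hT.le, le_rfl⟩ hε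
    refine ⟨min γ T, lt_min hγ hT, ?_⟩
    filter_upwards [ae_restrict_mem measurableSet_Ioo] with s hs
    have hsT : T - s ∈ Icc 0 T := ⟨by linarith [hs.2.trans_le (min_le_right γ T)], by linarith [hs.1]⟩
    exact hγ' (T - s) hsT (by
      rw [show T - s - T = -s by ring, abs_neg, abs_of_pos hs.1]
      exact hs.2.trans_le (min_le_left _ _))
  -- Step 3: pass to the limit in the identity
  have hlim := ((hlim0.sub hlimT).add hlimF)
  have hconst : Tendsto (fun k => (∫ t in Ioo 0 T, ρ k t * U t) - (∫ t in Ioo 0 T, ρ k (T - t) * U t) +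
      ∫ z, F z * χ k z.1 ∂μT) atTop (𝓝 0) := by
    simp only [hid]
    exact tendsto_const_nhds
  have := tendsto_nhds_unique hlim hconst
  linarith

end Bridge

/-! ## The corrected statements, keyed on the tree's weak Euler solutions -/

section Corrected

variable [DecidableEq d]
variable {T : ℝ} {u : ℝ → UnitAddTorus d → EuclideanSpace ℝ d}

/-- **The `L^{3/2}` pressure of a single `L³` weak Euler solution**, from the sequential
pressure fact `Torus.exists_pressure_of_tendsto_L3` (Duchon–Robert 2000, Prop. 1;
Robinson–Rodrigo–Sadowski 2016, Lemma 5.1 and Prop. 5.3) applied to the constant sequence. [cite: RobinsonRodrigoSadowski2016, Lemma 5.1 and Prop. 5.3] -/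
theorem _root_.Literature.Analysis.FunctionSpaces.Torus.IsWeakEulerSolutionOn.exists_pressure_of_fact
    (hA1 : exists_pressure_of_tendsto_L3 (T := T) (u := u))
    (hE : FunctionSpaces.Torus.IsWeakEulerSolutionOn T u)
    (hu3 : ∫⁻ t in Ioo 0 T, ∫⁻ x, ‖u t x‖ₑ ^ (3 : ℕ) < ∞) :
    ∃ p : ℝ → UnitAddTorus d → ℝ, IsDistributionalNSSolutionOn T 0 0 u p ∧
      ∫⁻ t in Ioo 0 T, ∫⁻ x, ‖p t x‖ₑ ^ (3 / 2 : ℝ) < ∞ := by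
  have hconv : Tendsto (fun _ : ℕ => ∫⁻ t in Ioo 0 T, ∫⁻ x, ‖u t x - u t x‖ₑ ^ (3 : ℕ)) atTop (𝓝 0) := by
    simp only [sub_self, enorm_zero, ne_eq, OfNat.ofNat_ne_zero, not_false_eq_true, zero_pow,
      lintegral_const, zero_mul]
    exact tendsto_const_nhds
  obtain ⟨-, p, -, hdist, hp32, -⟩ := hA1 (νseq := fun _ => 0) (ν := 0) (useq := fun _ => u)
    (Eventually.of_forall fun _ => hE) hE hconv hu3
  exact ⟨p, hdist, hp32⟩

/-- **The local 4/5 law for the tree's weak Euler solutions, corrected form of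
`HasDuchonRobertDefect.hasFourFifthsLaw`** (Novack 2024, Thm. 1; pressure by Duchon–Robert 2000,
Prop. 1 / Robinson–Rodrigo–Sadowski 2016, Ch. 5; defect identification by Duchon–Robert 2000,
Prop. 2). With *exactly the hypotheses of the misstated fact* — `D` a Duchon–Robert defect of a
weak Euler solution `u ∈ L³((0,T) × T^d)` (`IsWeakEulerSolutionOn`, pressure-free) — **plus**
Novack's standing hypothesis `u ∈ C⁰([0,T]; L²(T^d))`, `d ≥ 2` and `0 < T`, the local 4/5 law
`HasFourFifthsLaw T u D` holds, granted the three named facts of the printed chain (the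
Calderón–Zygmund pressure `exists_pressure_of_tendsto_L3`, Duchon–Robert's Prop. 2
`FluidPDE.duchon_robert_defect_exists`, Novack's Thm. 1 `novack2024_fourThirds_fourFifths`). [cite: Novack2024, Thm. 1] -/
theorem HasDuchonRobertDefect.hasFourFifthsLaw_of_isWeakEulerSolutionOn
    (hN : novack2024_fourThirds_fourFifths (d := d))
    (hA1 : exists_pressure_of_tendsto_L3 (T := T) (u := u))
    (hP2 : ∀ {p : ℝ → UnitAddTorus d → ℝ},
      FluidPDE.duchon_robert_defect_exists (T := T) (ν := 0) (u := u) (p := p))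
    (hd : 2 ≤ Fintype.card d) (hT : 0 < T) {D : STFunctional d} (h : HasDuchonRobertDefect T u D)
    (hE : FunctionSpaces.Torus.IsWeakEulerSolutionOn T u) (hu3 : ∫⁻ t in Ioo 0 T, ∫⁻ x, ‖u t x‖ₑ ^ (3 : ℕ) < ∞)
    (hC : ContinuousInLpOn (Icc 0 T) 2 u) : HasFourFifthsLaw T u D := by
  obtain ⟨p, hdist, hp32⟩ := hE.exists_pressure_of_fact hA1 hu3
  exact h.hasFourFifthsLaw_of_continuousInLp hN hP2 hd hT
    (hdist.isWeakEulerSolutionWithPressureOn hC hT) hC hu3 hp32 (hC.1 0 ⟨le_rfl, hT.le⟩)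

/-- **The local 4/3 law for the tree's weak Euler solutions, corrected form of
`HasDuchonRobertDefect.hasFourThirdsLaw`** (same chain of sources): under the hypotheses of
`hasFourFifthsLaw_of_isWeakEulerSolutionOn`, `HasFourThirdsLaw T u D`. [cite: Novack2024, Thm. 1] -/
theorem HasDuchonRobertDefect.hasFourThirdsLaw_of_isWeakEulerSolutionOn
    (hN : novack2024_fourThirds_fourFifths (d := d))
    (hA1 : exists_pressure_of_tendsto_L3 (T := T) (u := u))
    (hP2 : ∀ {p : ℝ → UnitAddTorus d → ℝ},
      FluidPDE.duchon_robert_defect_exists (T := T) (ν := 0) (u := u) (p := p))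
    (hd : 2 ≤ Fintype.card d) (hT : 0 < T) {D : STFunctional d} (h : HasDuchonRobertDefect T u D)
    (hE : FunctionSpaces.Torus.IsWeakEulerSolutionOn T u) (hu3 : ∫⁻ t in Ioo 0 T, ∫⁻ x, ‖u t x‖ₑ ^ (3 : ℕ) < ∞)
    (hC : ContinuousInLpOn (Icc 0 T) 2 u) : HasFourThirdsLaw T u D := by
  obtain ⟨p, hdist, hp32⟩ := hE.exists_pressure_of_fact hA1 hu3
  exact h.hasFourThirdsLaw_of_continuousInLp hN hP2 hd hT
    (hdist.isWeakEulerSolutionWithPressureOn hC hT) hC hu3 hp32 (hC.1 0 ⟨le_rfl, hT.le⟩)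

/-- **The transverse (`8/15`-type) law for the tree's weak Euler solutions** (Novack 2024, Thm. 1,
line `• = T`, same chain of sources): under the hypotheses of
`hasFourFifthsLaw_of_isWeakEulerSolutionOn` and granted `novack2024_transverseLaw`, for every test
function `ψ` supported in `(0,T) × T^d`,
`∫₀ᵀ∫ ℓ⁻¹ ⨍ δ_L u |δu_T|²(ℓω) dω ψ → −(4(d−1)/(d(d+2))) D ψ` as `ℓ → 0⁺`. [cite: Novack2024, Thm. 1] -/
theorem HasDuchonRobertDefect.tendsto_mixedFlux_of_isWeakEulerSolutionOn
    (hN : novack2024_transverseLaw (d := d))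
    (hA1 : exists_pressure_of_tendsto_L3 (T := T) (u := u))
    (hP2 : ∀ {p : ℝ → UnitAddTorus d → ℝ},
      FluidPDE.duchon_robert_defect_exists (T := T) (ν := 0) (u := u) (p := p))
    (hd : 2 ≤ Fintype.card d) (hT : 0 < T) {D : STFunctional d} (h : HasDuchonRobertDefect T u D)
    (hE : FunctionSpaces.Torus.IsWeakEulerSolutionOn T u) (hu3 : ∫⁻ t in Ioo 0 T, ∫⁻ x, ‖u t x‖ₑ ^ (3 : ℕ) < ∞)
    (hC : ContinuousInLpOn (Icc 0 T) 2 u)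
    {ψ : ℝ → UnitAddTorus d → ℝ} (hψ : FunctionSpaces.Torus.IsSpaceTimeTestIoo T ψ) :
    Tendsto (fun ℓ => ∫ t in Ioo 0 T, ∫ x, ℓ⁻¹ * mixedFluxSphereAvg (u t) ℓ x * ψ t x) (𝓝[>] 0)
      (𝓝 (-(4 * ((Fintype.card d : ℝ) - 1) /
        ((Fintype.card d : ℝ) * ((Fintype.card d : ℝ) + 2))) * D ψ)) := by
  obtain ⟨p, hdist, hp32⟩ := hE.exists_pressure_of_fact hA1 hu3
  exact h.tendsto_mixedFlux_of_continuousInLp hN hP2 hd hT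
    (hdist.isWeakEulerSolutionWithPressureOn hC hT) hC hu3 hp32 (hC.1 0 ⟨le_rfl, hT.le⟩) hψ

end Corrected

end Literature.Analysis.FluidPDE.Torus
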